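import Literature.Analysis.PDE.QuasilinearEstimates
import Literature.Analysis.PDE.QuasilinearFlatSharp
import Literature.Analysis.PDE.LinExistTools
import Literature.Analysis.PDE.PatchLowerOrder
import Literature.Analysis.PDE.MaxRegEstimate
import HarnessLib

/-!
# The frozen Picard scheme for quasilinear parabolic systems: localisation and smallness glue
# (topic `Analysis/PDE`)

Layer (III), step 5c (part 1), of the programme to prove short-time existence for quasilinear
strictly parabolic systems on a closed manifold (hypothesis `hQL` of
`Literature.Geometry.Riemannian.ricciFlow_shortTime_existence_of_quasilinear`). The extended
chart expressions `z_p(f) = cutPlus_p • (f ∘ κ_p⁻¹)` of a function on `M` are the unknowns of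
the flat form of the Picard source; this file relates their energies and sup norms to the
energies of the cut-off expressions `cutExpr_q f` of the linear theory:

* `PatchSystemLoc.zExpr` and its smoothness / compact support / agreement with `f ∘ κ_p⁻¹` on
  the inner balls;
* `PatchSystemLoc.sobolevEnergy_zExpr_le` — `E_i(z_p(f)) ≤ C_loc Σ_q E_i(cutExpr_q f)`;
* `PatchSystemLoc.norm_iteratedFDeriv_zExpr_le` — Sobolev: if `E_{m₀+n'}(cutExpr_q f) ≤ ε²` for
  all `q` then `‖Dᵐ z_p(f)‖ ≤ C_s ε` for `m ≤ m₀` (`n' = 2 (dim + 1)`);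
* `PatchSystemLoc.norm_apply_le_of_zExpr` — `‖f x‖ ≤ sup ‖z_{p(x)}(f)‖`.

Everything is proved; no named fact and no `sorry` is introduced.

## References

* M. E. Taylor, *Partial Differential Equations III*, 2nd ed., Springer 2011, Ch. 15, §7.
  [TaylorPDEIII2011]
-/

noncomputable section

open Set Function Filter Topology Metric MeasureTheory InnerProductSpace
open scoped Manifold ContDiff Topology ENNReal RealInnerProductSpace

namespace Literature.Analysis.PDE

open Literature.Geometry.Manifold Literature.Analysis.FunctionSpaces Literature.Analysis.FluidPDE

variable {E : Type*} [NormedAddCommGroup E] [NormedSpace ℝ E] {H : Type*} [TopologicalSpace H]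
variable {I : ModelWithCorners ℝ E H} {M : Type*} [TopologicalSpace M] [ChartedSpace H M]
variable {E' : Type*} [NormedAddCommGroup E'] [InnerProductSpace ℝ E'] [FiniteDimensional ℝ E']
  [MeasurableSpace E'] [BorelSpace E']
variable {F' : Type*} [NormedAddCommGroup F'] [InnerProductSpace ℝ F']
variable {ι : Type*} [Fintype ι] (P : PatchSystem I M E' ι)

namespace PatchSystemLoc

/-! ### The extended chart expressions -/

/-- **The extended chart expression** `z_p(f) = cutPlus_p • (f ∘ κ_p⁻¹)` (zero-extended).
[cite: Lee2013, Thm. 2.23] -/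
def zExpr (p : ι) (f : M → F') (y : E') : F' := P.cutPlus p y • f ((P.chart p).inv y)

omit [MeasurableSpace E'] [BorelSpace E'] in
/-- `zExpr_apply`: unfolding. [folklore] -/
@[simp] theorem zExpr_apply (p : ι) (f : M → F') (y : E') : zExpr P p f y = P.cutPlus p y • f ((P.chart p).inv y) := rfl

omit [MeasurableSpace E'] [BorelSpace E'] in
/-- The extended chart expression of a chart-smooth function is smooth. [folklore] -/
theorem contDiff_zExpr [I.Boundaryless] [HasContDiffBump E'] (p : ι) {f : M → F'} (hf : ContDiffOn ℝ ∞ (f ∘ (P.chart p).inv) (P.chart p).target) :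
    ContDiff ℝ ∞ (zExpr P p f) :=
  contDiff_smul_of_tsupport_subset (P.chart p).isOpen_target (P.cutPlus p).contDiff (P.tsupport_cutPlus_subset p) hf

omit [MeasurableSpace E'] [BorelSpace E'] in
/-- The extended chart expression has compact support (in `B̄(0, 4rₚ)`). [folklore] -/
theorem hasCompactSupport_zExpr (p : ι) (f : M → F') : HasCompactSupport (zExpr P p f) :=
  HasCompactSupport.smul_right (f' := f ∘ (P.chart p).inv) (P.cutPlus p).hasCompactSupport

omit [MeasurableSpace E'] [BorelSpace E'] in
/-- On `B(0, 3rₚ)` the extended chart expression is `f ∘ κ_p⁻¹` (eventually). [folklore] -/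
theorem zExpr_eventuallyEq (p : ι) (f : M → F') {y : E'} (hy : y ∈ ball (0 : E') (3 * P.r p)) :
    zExpr P p f =ᶠ[𝓝 y] (f ∘ (P.chart p).inv) := by
  filter_upwards [isOpen_ball.mem_nhds hy] with y' hy'
  have h1 : P.cutPlus p y' = 1 := ContDiffBump.one_of_mem_closedBall _ (by rw [PatchSystem.cutPlus_rIn]; exact ball_subset_closedBall hy')
  simp [zExpr, h1]

omit [MeasurableSpace E'] [BorelSpace E'] in
/-- At the cover chart of `x`: `f x = z_p(f)(κ_p x)`. [folklore] -/
theorem apply_eq_zExpr_map {p : ι} (f : M → F') {x : M} (hx : x ∈ (P.chart p).source) (hmx : (P.chart p).map x ∈ ball (0 : E') (3 * P.r p)) :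
    f x = zExpr P p f ((P.chart p).map x) := by
  have h1 : P.cutPlus p ((P.chart p).map x) = 1 := ContDiffBump.one_of_mem_closedBall _ (by rw [PatchSystem.cutPlus_rIn]; exact ball_subset_closedBall hmx)
  rw [zExpr_apply, h1, one_smul, (P.chart p).inv_map hx]

omit [MeasurableSpace E'] [BorelSpace E'] in
/-- **`‖f x‖` is dominated by the sup of the extended chart expressions.** [folklore] -/
theorem norm_apply_le_of_zExpr (f : M → F') {R : ℝ} (hR : ∀ p y, ‖zExpr P p f y‖ ≤ R) (x : M) : ‖f x‖ ≤ R := by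
  obtain ⟨p, hxp, hpx⟩ := P.cover x
  have h := apply_eq_zExpr_map P f hxp (ball_subset_ball (by linarith [P.r_pos p]) hpx)
  calc ‖f x‖ = ‖zExpr P p f ((P.chart p).map x)‖ := by rw [← h]
    _ ≤ R := hR p _

/-! ### Localisation of energies -/

/-- **Energies of the extended chart expressions**: `E_i(z_p(f)) ≤ C_loc Σ_q E_i(cutExpr_q f)` for
chart-smooth `f`, uniformly in `p`. [cite: Hormander1985III, §17.1] -/
theorem sobolevEnergy_zExpr_le [T2Space M] [I.Boundaryless] [IsManifold I ∞ M] [HasContDiffBump E'] (i : ℕ) :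
    ∃ C : ℝ≥0∞, C ≠ ⊤ ∧ ∀ p {f : M → F'}, (∀ q, ContDiffOn ℝ ∞ (f ∘ (P.chart q).inv) (P.chart q).target) →
      sobolevEnergy i (zExpr P p f) ≤ C * ∑ q, sobolevEnergy i (cutExpr P q f) := by
  have hp : ∀ p, ∃ C : ℝ≥0∞, C ≠ ⊤ ∧ ∀ {f : M → F'}, (∀ q, ContDiffOn ℝ ∞ (f ∘ (P.chart q).inv) (P.chart q).target) →
      sobolevEnergy i (fun y ↦ P.cutPlus p y • f ((P.chart p).inv y)) ≤ C * ∑ q, sobolevEnergy i (cutExpr P q f) := fun p ↦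
    sobolevEnergy_smul_comp_inv_le P p (P.cutPlus p).contDiff (isCompact_closedBall _ _) (P.closedBall_subset_target p le_rfl)
      (tsupport_cutPlus_subset_closedBall p) i
  choose C hCtop hC using hp
  refine ⟨∑ p, C p, ENNReal.sum_ne_top.2 fun p _ ↦ hCtop p, fun p f hf ↦ (hC p hf).trans ?_⟩
  exact mul_le_mul' (Finset.single_le_sum (f := C) (fun _ _ ↦ bot_le) (Finset.mem_univ p)) le_rfl

/-! ### Sup bounds from energies -/

/-- **Sobolev for the extended chart expressions.** For every `m₀` there is `C_s ≥ 0` such that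
for chart-smooth `f` with `E_{m₀ + n'}(cutExpr_q f) ≤ ε²` for all `q` (`n' = 2 (dim E' + 1)`),
`‖Dᵐ z_p(f)(y)‖ ≤ C_s ε` for all `m ≤ m₀`, `p`, `y`. [cite: Evans2010, §5.6.3] -/
theorem norm_iteratedFDeriv_zExpr_le [FiniteDimensional ℝ F'] [T2Space M] [I.Boundaryless] [IsManifold I ∞ M] [HasContDiffBump E'] (m₀ : ℕ) :
    ∃ Cs : ℝ, 0 ≤ Cs ∧ ∀ p {f : M → F'}, (∀ q, ContDiffOn ℝ ∞ (f ∘ (P.chart q).inv) (P.chart q).target) →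
      ∀ {ε : ℝ}, 0 ≤ ε → (∀ q, sobolevEnergy (m₀ + 2 * (Module.finrank ℝ E' + 1)) (cutExpr P q f) ≤ ENNReal.ofReal (ε ^ 2)) →
      ∀ m ≤ m₀, ∀ y, ‖iteratedFDeriv ℝ m (zExpr P p f) y‖ ≤ Cs * ε := by
  classical
  set n := Module.finrank ℝ E' with hn
  obtain ⟨Csob, hCsobtop, hCsob⟩ := enorm_iterDirDeriv_sq_le (E' := E') (F' := F')
  obtain ⟨Cloc, hCloctop, hCloc⟩ := sobolevEnergy_zExpr_le P (F' := F') (m₀ + 2 * (n + 1))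
  -- the real constant
  set A : ℝ := Real.sqrt ((Csob * Cloc * (Fintype.card ι : ℝ≥0∞)).toReal) with hA
  have hA0 : 0 ≤ A := Real.sqrt_nonneg _
  refine ⟨(n : ℝ) ^ m₀ * A + A, by positivity, fun p f hf ε hε hE m hm y ↦ ?_⟩
  have hz : ContDiff ℝ ∞ (zExpr P p f) := contDiff_zExpr P p (hf p)
  have hzc : HasCompactSupport (zExpr P p f) := hasCompactSupport_zExpr P p f
  -- every frame word of length `≤ m₀` is bounded by `A ε`
  have hword : ∀ β : List (Fin n), β.length ≤ m₀ → ∀ x, ‖iterDirDeriv (β.map (stdOrthonormalBasis ℝ E')) (zExpr P p f) x‖ ≤ A * ε := by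
    intro β hβ x
    have h1 := hCsob hz hzc β x
    have h2 : sobolevEnergy (2 * (n + 1) + β.length) (zExpr P p f) ≤ Cloc * ((Fintype.card ι : ℝ≥0∞) * ENNReal.ofReal (ε ^ 2)) := by
      refine (sobolevEnergy_mono (show 2 * (n + 1) + β.length ≤ m₀ + 2 * (n + 1) by omega) _).trans ((hCloc p hf).trans ?_)
      refine mul_le_mul' le_rfl ?_
      calc ∑ q, sobolevEnergy (m₀ + 2 * (n + 1)) (cutExpr P q f) ≤ ∑ _q : ι, ENNReal.ofReal (ε ^ 2) := Finset.sum_le_sum fun q _ ↦ hE q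
        _ = _ := by rw [Finset.sum_const, Finset.card_univ, nsmul_eq_mul]
    have h3 : ‖iterDirDeriv (β.map (stdOrthonormalBasis ℝ E')) (zExpr P p f) x‖ₑ ^ 2 ≤ (Csob * Cloc * (Fintype.card ι : ℝ≥0∞)) * ENNReal.ofReal (ε ^ 2) := by
      refine h1.trans ((mul_le_mul' le_rfl h2).trans_eq ?_); ring
    have htop : Csob * Cloc * (Fintype.card ι : ℝ≥0∞) ≠ ⊤ := ENNReal.mul_ne_top (ENNReal.mul_ne_top hCsobtop hCloctop) (ENNReal.natCast_ne_top _)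
    -- convert to a real inequality
    have h4 : ‖iterDirDeriv (β.map (stdOrthonormalBasis ℝ E')) (zExpr P p f) x‖ ^ 2 ≤ (Csob * Cloc * (Fintype.card ι : ℝ≥0∞)).toReal * ε ^ 2 := by
      have h := ENNReal.toReal_mono (ENNReal.mul_ne_top htop ENNReal.ofReal_ne_top) h3
      rw [← ofReal_norm, ← ENNReal.ofReal_pow (norm_nonneg _), ENNReal.toReal_ofReal (sq_nonneg _), ENNReal.toReal_mul,
        ENNReal.toReal_ofReal (sq_nonneg _)] at h
      exact h
    have h5 : (Csob * Cloc * (Fintype.card ι : ℝ≥0∞)).toReal * ε ^ 2 = (A * ε) ^ 2 := by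
      rw [mul_pow, hA, Real.sq_sqrt ENNReal.toReal_nonneg]
    rw [h5] at h4
    exact (sq_le_sq₀ (norm_nonneg _) (mul_nonneg hA0 hε)).1 h4
  -- words of fixed length as functions on `Fin m → Fin n`
  have hword' : ∀ m ≤ m₀, ∀ (v : Fin m → Fin n) x, ‖iterDirDeriv (List.ofFn fun k ↦ stdOrthonormalBasis ℝ E' (v k)) (zExpr P p f) x‖ ≤ A * ε := by
    intro m hm v x
    have h := hword (List.ofFn v) (by rw [List.length_ofFn]; exact hm) x
    rwa [List.map_ofFn] at h
  have h1 := norm_iteratedFDeriv_le_of_frame_words hz m y (mul_nonneg hA0 hε) fun v ↦ hword' m hm v y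
  refine h1.trans ?_
  have hnm : (n : ℝ) ^ m ≤ (n : ℝ) ^ m₀ + 1 := by
    rcases Nat.eq_zero_or_pos n with h0 | hpos
    · rw [h0]; rcases Nat.eq_zero_or_pos m with rfl | hm0
      · simp
      · rw [Nat.cast_zero, zero_pow hm0.ne']; positivity
    · exact (pow_le_pow_right₀ (by exact_mod_cast hpos) hm).trans (le_add_of_nonneg_right zero_le_one)
  calc (n : ℝ) ^ m * (A * ε) ≤ ((n : ℝ) ^ m₀ + 1) * (A * ε) := mul_le_mul_of_nonneg_right hnm (mul_nonneg hA0 hε)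
    _ = ((n : ℝ) ^ m₀ * A + A) * ε := by ring

end PatchSystemLoc

/-! ### The data of the frozen Picard scheme -/

section Data

variable (I M E')

/-- **Data of the frozen Picard scheme**: a patch system, a frame basis, the represented operator
`P` with its chart data `(a, f)` on the open jet set `𝒪` (hypotheses of `hQL` at the patch
centres), the smooth base `u₀` with graph in `𝒪`, and jet radii `ρ, ρ'` adapted to the shifted
jet domains over the outer balls. [cite: TaylorPDEIII2011, Ch. 15, §7] -/
structure PicardData (W' : Type*) [NormedAddCommGroup W'] [InnerProductSpace ℝ W'] (ιb : Type*) [Fintype ιb] (ι : Type*) [Fintype ι] where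
  PS : PatchSystem I M E' ι
  b : Module.Basis ιb ℝ E
  𝒪 : Set (M × W')
  P : (M → W') → M → W'
  a : M → E × W' × (E →L[ℝ] W') → ιb → ιb → ℝ
  f : M → E × W' × (E →L[ℝ] W') → W'
  u₀ : M → W'
  ρ : ℝ
  ρ' : ℝ
  h𝒪 : IsOpen 𝒪
  ha : ∀ p i i', ContDiffOn ℝ ∞ (fun j ↦ a (PS.chart p).z j i i')
    {j | j.1 ∈ (extChartAt I (PS.chart p).z).target ∧ ((extChartAt I (PS.chart p).z).symm j.1, j.2.1) ∈ 𝒪}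
  hf : ∀ p, ContDiffOn ℝ ∞ (f (PS.chart p).z) {j | j.1 ∈ (extChartAt I (PS.chart p).z).target ∧ ((extChartAt I (PS.chart p).z).symm j.1, j.2.1) ∈ 𝒪}
  hP : ∀ p, ∀ u : M → W', ContMDiff I 𝓘(ℝ, W') ∞ u → (∀ x, (x, u x) ∈ 𝒪) → ∀ η ∈ (extChartAt I (PS.chart p).z).target,
    P u ((extChartAt I (PS.chart p).z).symm η) =
      (∑ i, ∑ i', a (PS.chart p).z (η, u ((extChartAt I (PS.chart p).z).symm η), fderiv ℝ (u ∘ (extChartAt I (PS.chart p).z).symm) η) i i' •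
        fderiv ℝ (fderiv ℝ (u ∘ (extChartAt I (PS.chart p).z).symm)) η (b i) (b i')) +
      f (PS.chart p).z (η, u ((extChartAt I (PS.chart p).z).symm η), fderiv ℝ (u ∘ (extChartAt I (PS.chart p).z).symm) η)
  hu₀ : ContMDiff I 𝓘(ℝ, W') ∞ u₀
  hg₀ : ∀ x, (x, u₀ x) ∈ 𝒪
  hρ : 0 < ρ
  hρ' : 0 < ρ'
  hρρ : 2 * ((Module.finrank ℝ E' : ℝ) + 1) * ρ' ^ 2 ≤ ρ ^ 2
  hKΩ : ∀ p, ∀ y ∈ closedBall (0 : E') (4 * PS.r p), ∀ J : W' × (E' →L[ℝ] W'), ‖J‖ ≤ ρ → (y, J) ∈ shiftDom (PS.chart p) 𝒪 u₀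

variable {I M E'}

namespace PicardData

variable {W' : Type*} [NormedAddCommGroup W'] [InnerProductSpace ℝ W'] {ιb : Type*} [Fintype ιb]
variable (D : PicardData I M E' W' ιb ι)

/-- The frame vectors `A_p bᵢ`. [folklore] -/
def Av (p : ι) (i : ιb) : E' := (D.PS.chart p).A (D.b i)

/-- The cut-off top coefficient of patch `p`. [folklore] -/
def Gc (p : ι) (i i' : ιb) : E' × (W' × (E' →L[ℝ] W')) → ℝ := cutoffExt (D.PS.cutPlus p) D.ρ' (rawGc (D.PS.chart p) D.a D.u₀ i i')

/-- The cut-off remainder of patch `p`. [folklore] -/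
def Gr (p : ι) : E' × (W' × (E' →L[ℝ] W')) → W' := cutoffExt (D.PS.cutPlus p) D.ρ' (rawGr (D.PS.chart p) D.b D.a D.f D.u₀)

/-- The fixed source `cutExpr_p (P u₀)`. [folklore] -/
def g₀ (p : ι) : E' → W' := PatchSystemLoc.cutExpr D.PS p (D.P D.u₀)

/-- The Picard source `Θ(v) = P(u₀ + v) - L v`. [cite: TaylorPDEIII2011, Ch. 15, §7] -/
def theta (v : M → W') (x : M) : W' := D.P (fun x' ↦ D.u₀ x' + v x') x - linOp D.P D.u₀ v x

/-- The flat form of patch `p`. [folklore] -/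
def flat (p : ι) (z : E' → W') : E' → W' := thetaFlat (D.Av p) (D.PS.cut p) (D.Gc p) (D.Gr p) (D.g₀ p) z

variable [I.Boundaryless] [HasContDiffBump E']

omit [FiniteDimensional ℝ E'] [MeasurableSpace E'] [BorelSpace E'] [I.Boundaryless] [HasContDiffBump E'] in
/-- The chart expressions of `u₀` are smooth. [folklore] -/
theorem contDiffOn_u₀ [IsManifold I ∞ M] (p : ι) : ContDiffOn ℝ ∞ (D.u₀ ∘ (D.PS.chart p).inv) (D.PS.chart p).target :=
  (D.PS.chart p).contDiffOn_comp_inv D.hu₀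

omit [MeasurableSpace E'] [BorelSpace E'] in
/-- **Smoothness of the cut-off top coefficients.** [folklore] -/
theorem contDiff_Gc [IsManifold I ∞ M] (p : ι) (i i' : ιb) : ContDiff ℝ ∞ (D.Gc p i i') :=
  contDiff_flatGc p D.h𝒪 (D.ha p) (D.contDiffOn_u₀ p) (fun _ _ ↦ D.hg₀ _) D.hρ D.hρ' D.hρρ (D.hKΩ p) i i'

omit [MeasurableSpace E'] [BorelSpace E'] in
/-- **Smoothness of the cut-off remainders.** [folklore] -/
theorem contDiff_Gr [IsManifold I ∞ M] (p : ι) : ContDiff ℝ ∞ (D.Gr p) :=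
  contDiff_flatGr p D.h𝒪 (D.ha p) (D.hf p) (D.contDiffOn_u₀ p) (fun _ _ ↦ D.hg₀ _) D.hρ D.hρ' D.hρρ (D.hKΩ p)

omit [MeasurableSpace E'] [BorelSpace E'] [I.Boundaryless] [HasContDiffBump E'] in
/-- Compact support of the cut-off top coefficients. [folklore] -/
theorem hasCompactSupport_Gc [FiniteDimensional ℝ W'] (p : ι) (i i' : ιb) : HasCompactSupport (D.Gc p i i') :=
  hasCompactSupport_flatG p D.hρ' _

omit [MeasurableSpace E'] [BorelSpace E'] [I.Boundaryless] [HasContDiffBump E'] in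
/-- Compact support of the cut-off remainders. [folklore] -/
theorem hasCompactSupport_Gr [FiniteDimensional ℝ W'] (p : ι) : HasCompactSupport (D.Gr p) :=
  hasCompactSupport_flatG p D.hρ' _

omit [MeasurableSpace E'] [BorelSpace E'] [I.Boundaryless] [HasContDiffBump E'] in
/-- The cut-off top coefficients vanish at the zero jet. [folklore] -/
@[simp] theorem Gc_zero (p : ι) (i i' : ιb) (y : E') : D.Gc p i i' (y, 0) = 0 := flatGc_zero p D.ρ' D.a D.u₀ i i' y

omit [MeasurableSpace E'] [BorelSpace E'] [HasContDiffBump E'] in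
/-- The fixed sources are smooth. [folklore] -/
theorem contDiff_g₀ [IsManifold I ∞ M] (p : ι) : ContDiff ℝ ∞ (D.g₀ p) :=
  PatchSystemLoc.contDiff_cutExpr D.PS (contDiffOn_apply_comp_inv (b := D.b) (D.PS.chart p) (D.ha p) (D.hf p) (D.hP p) D.hu₀ D.hg₀)

omit [MeasurableSpace E'] [BorelSpace E'] [I.Boundaryless] [HasContDiffBump E'] in
/-- The fixed sources have compact support. [folklore] -/
theorem hasCompactSupport_g₀ (p : ι) : HasCompactSupport (D.g₀ p) := PatchSystemLoc.hasCompactSupport_cutExpr D.PS _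

omit [MeasurableSpace E'] [BorelSpace E'] in
/-- **The identity**: `cutExpr_p (Θ v) = flat_p (z_p(v))` for `v` smooth with `u₀ + v` graph in
`𝒪` and `ρ'`-small own-chart jets on the supports of the cut-offs. [cite: MantegazzaMartinazzi2012, §3] -/
theorem cutExpr_theta_eq [CompactSpace M] [IsManifold I ∞ M] (p : ι) {v : M → W'} (hv : ContMDiff I 𝓘(ℝ, W') ∞ v)
    (hgv : ∀ x, (x, D.u₀ x + v x) ∈ D.𝒪) (hjet : ∀ y, D.PS.cut p y ≠ 0 → jetQ (jetOf (v ∘ (D.PS.chart p).inv) y) ≤ D.ρ' ^ 2) :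
    PatchSystemLoc.cutExpr D.PS p (D.theta v) = D.flat p (PatchSystemLoc.zExpr D.PS p v) :=
  cutExpr_theta_eq_thetaFlat (b := D.b) D.PS p D.h𝒪 (D.ha p) (D.hf p) (D.hP p) D.hu₀ D.hg₀ hv hgv D.hρ' hjet

omit [MeasurableSpace E'] [BorelSpace E'] in
/-- **Chart-slab smoothness of the Picard source** along a chart-slab-smooth `v` with admissible
graphs. [cite: MantegazzaMartinazzi2012, §3] -/
theorem theta_chartSlabSmooth' [CompactSpace M] [IsManifold I ∞ M] {T : ℝ} (hT : 0 < T) {v : ℝ → M → W'}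
    (hv : ∀ q, ContDiffOn ℝ ∞ (uncurry fun s y ↦ v s ((D.PS.chart q).inv y)) (Icc 0 T ×ˢ (D.PS.chart q).target))
    (hvs : ∀ s ∈ Icc 0 T, ContMDiff I 𝓘(ℝ, W') ∞ (v s)) (hgv : ∀ s ∈ Icc 0 T, ∀ x, (x, D.u₀ x + v s x) ∈ D.𝒪) (q : ι) :
    ContDiffOn ℝ ∞ (uncurry fun s y ↦ D.theta (v s) ((D.PS.chart q).inv y)) (Icc 0 T ×ˢ (D.PS.chart q).target) :=
  theta_chartSlabSmooth (b := D.b) D.PS hT D.h𝒪 D.ha D.hf D.hP D.hu₀ D.hg₀ hv hvs hgv q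

end PicardData

end Data

/-! ### The gain of the weights: lower energies by the maximal-regularity quantity -/

section Gain

/-- `E_{k+1}(f) ≤ E_k(f) + Σᵢ E_k(∂ᵢ f)`. [folklore] -/
theorem sobolevEnergy_succ_le_add (k : ℕ) (f : E' → F') :
    sobolevEnergy (k + 1) f ≤ sobolevEnergy k f + ∑ i, sobolevEnergy k (fun x ↦ fderiv ℝ f x (stdOrthonormalBasis ℝ E' i)) := by
  rw [sobolevEnergy_succ]
  refine add_le_add ?_ le_rfl
  have h := sobolevEnergy_mono (Nat.zero_le k) f
  rwa [sobolevEnergy_zero_left] at h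

/-- `E_{k+2}(f) ≤ E_k(f) + 2 Σᵢ E_k(∂ᵢ f) + Σᵢⱼ E_k(∂ⱼ ∂ᵢ f)`. [folklore] -/
theorem sobolevEnergy_succ_succ_le_add (k : ℕ) (f : E' → F') :
    sobolevEnergy (k + 2) f ≤ sobolevEnergy k f + 2 * ∑ i, sobolevEnergy k (fun x ↦ fderiv ℝ f x (stdOrthonormalBasis ℝ E' i)) +
      ∑ i, ∑ j, sobolevEnergy k (fun x ↦ fderiv ℝ (fun y ↦ fderiv ℝ f y (stdOrthonormalBasis ℝ E' i)) x (stdOrthonormalBasis ℝ E' j)) := by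
  set e := stdOrthonormalBasis ℝ E' with he
  have h1 := sobolevEnergy_succ_le_add (F' := F') (k + 1) f
  have h2 := sobolevEnergy_succ_le_add (F' := F') k f
  have h3 : ∀ i, sobolevEnergy (k + 1) (fun x ↦ fderiv ℝ f x (e i)) ≤ sobolevEnergy k (fun x ↦ fderiv ℝ f x (e i)) +
      ∑ j, sobolevEnergy k (fun x ↦ fderiv ℝ (fun y ↦ fderiv ℝ f y (e i)) x (e j)) := fun i ↦ sobolevEnergy_succ_le_add k _
  calc sobolevEnergy (k + 2) f ≤ sobolevEnergy (k + 1) f + ∑ i, sobolevEnergy (k + 1) (fun x ↦ fderiv ℝ f x (e i)) := h1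
    _ ≤ (sobolevEnergy k f + ∑ i, sobolevEnergy k (fun x ↦ fderiv ℝ f x (e i))) +
          ∑ i, (sobolevEnergy k (fun x ↦ fderiv ℝ f x (e i)) + ∑ j, sobolevEnergy k (fun x ↦ fderiv ℝ (fun y ↦ fderiv ℝ f y (e i)) x (e j))) :=
        add_le_add h2 (Finset.sum_le_sum fun i _ ↦ h3 i)
    _ = _ := by rw [Finset.sum_add_distrib]; ring

/-- **The gain of the weights.** For `λ ≥ 1` and any slab family `w`:
`∫₀ᵗ e^{-2λs} E_{k+2}(w s) ≤ 2 · maxRegQ k λ w t` and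
`∫₀ᵗ e^{-2λs} E_{k+1}(w s) ≤ λ⁻¹ · maxRegQ k λ w t`. [cite: Evans2010, §7.1.3] -/
theorem lintegral_weight_sobolevEnergy_le_maxRegQ (k : ℕ) {lam : ℝ} (hlam : 1 ≤ lam) (w : ℝ → E' → F') (t : ℝ) :
    (∫⁻ s in Ioo 0 t, ENNReal.ofReal (Real.exp (-2 * lam * s)) * sobolevEnergy (k + 2) (w s)) ≤ 2 * PatchSystemLoc.maxRegQ k lam w t ∧
    (∫⁻ s in Ioo 0 t, ENNReal.ofReal (Real.exp (-2 * lam * s)) * sobolevEnergy (k + 1) (w s)) ≤ ENNReal.ofReal lam⁻¹ * PatchSystemLoc.maxRegQ k lam w t := by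
  set e := stdOrthonormalBasis ℝ E' with he
  have hlam0 : 0 < lam := by linarith
  have hl1 : (1 : ℝ≥0∞) ≤ ENNReal.ofReal lam := by rw [← ENNReal.ofReal_one]; exact ENNReal.ofReal_le_ofReal hlam
  have hl2 : (1 : ℝ≥0∞) ≤ ENNReal.ofReal (lam ^ 2) := by rw [← ENNReal.ofReal_one]; exact ENNReal.ofReal_le_ofReal (by nlinarith)
  have htop : ∀ s, sobolevEnergy (k + 2) (w s) ≤ 2 * ((∑ i, ∑ j, sobolevEnergy k (fun x ↦ fderiv ℝ (fun y ↦ fderiv ℝ (w s) y (e i)) x (e j))) +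
      ENNReal.ofReal lam * ∑ i, sobolevEnergy k (fun x ↦ fderiv ℝ (w s) x (e i)) + ENNReal.ofReal (lam ^ 2) * sobolevEnergy k (w s)) := by
    intro s
    refine (sobolevEnergy_succ_succ_le_add k (w s)).trans ?_
    set A := ∑ i, ∑ j, sobolevEnergy k (fun x ↦ fderiv ℝ (fun y ↦ fderiv ℝ (w s) y (e i)) x (e j)) with hA
    set B := ∑ i, sobolevEnergy k (fun x ↦ fderiv ℝ (w s) x (e i)) with hB
    set C := sobolevEnergy k (w s) with hC
    calc C + 2 * B + A ≤ ENNReal.ofReal (lam ^ 2) * C + 2 * (ENNReal.ofReal lam * B) + A :=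
          add_le_add (add_le_add (le_mul_of_one_le_left' hl2) (mul_le_mul' le_rfl (le_mul_of_one_le_left' hl1))) le_rfl
      _ ≤ ENNReal.ofReal (lam ^ 2) * C + 2 * (ENNReal.ofReal lam * B) + A + (A + ENNReal.ofReal (lam ^ 2) * C) := le_self_add
      _ = 2 * (A + ENNReal.ofReal lam * B + ENNReal.ofReal (lam ^ 2) * C) := by ring
  have hinv : ENNReal.ofReal lam⁻¹ * ENNReal.ofReal lam = 1 := by
    rw [← ENNReal.ofReal_mul (inv_nonneg.2 hlam0.le), inv_mul_cancel₀ hlam0.ne', ENNReal.ofReal_one]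
  have hinv2 : ENNReal.ofReal lam⁻¹ * ENNReal.ofReal (lam ^ 2) = ENNReal.ofReal lam := by
    rw [← ENNReal.ofReal_mul (inv_nonneg.2 hlam0.le)]; congr 1; field_simp
  have hlow : ∀ s, sobolevEnergy (k + 1) (w s) ≤ ENNReal.ofReal lam⁻¹ * ((∑ i, ∑ j, sobolevEnergy k (fun x ↦ fderiv ℝ (fun y ↦ fderiv ℝ (w s) y (e i)) x (e j))) +
      ENNReal.ofReal lam * ∑ i, sobolevEnergy k (fun x ↦ fderiv ℝ (w s) x (e i)) + ENNReal.ofReal (lam ^ 2) * sobolevEnergy k (w s)) := by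
    intro s
    refine (sobolevEnergy_succ_le_add k (w s)).trans ?_
    set A := ∑ i, ∑ j, sobolevEnergy k (fun x ↦ fderiv ℝ (fun y ↦ fderiv ℝ (w s) y (e i)) x (e j)) with hA
    set B := ∑ i, sobolevEnergy k (fun x ↦ fderiv ℝ (w s) x (e i)) with hB
    set C := sobolevEnergy k (w s) with hC
    calc C + B ≤ ENNReal.ofReal lam * C + B := add_le_add (le_mul_of_one_le_left' hl1) le_rfl
      _ = ENNReal.ofReal lam⁻¹ * (ENNReal.ofReal lam * B + ENNReal.ofReal (lam ^ 2) * C) := by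
          rw [mul_add, ← mul_assoc, ← mul_assoc, hinv, hinv2]; ring
      _ ≤ ENNReal.ofReal lam⁻¹ * (A + ENNReal.ofReal lam * B + ENNReal.ofReal (lam ^ 2) * C) := by
          refine mul_le_mul' le_rfl ?_
          rw [add_assoc]; exact le_add_self
  constructor
  · rw [PatchSystemLoc.maxRegQ_eq, ← lintegral_const_mul' _ _ (by norm_num)]
    refine lintegral_mono fun s ↦ ?_
    calc _ ≤ ENNReal.ofReal (Real.exp (-2 * lam * s)) * (2 * ((∑ i, ∑ j, sobolevEnergy k (fun x ↦ fderiv ℝ (fun y ↦ fderiv ℝ (w s) y (e i)) x (e j))) +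
          ENNReal.ofReal lam * ∑ i, sobolevEnergy k (fun x ↦ fderiv ℝ (w s) x (e i)) + ENNReal.ofReal (lam ^ 2) * sobolevEnergy k (w s))) :=
          mul_le_mul' le_rfl (htop s)
      _ = _ := by ring
  · rw [PatchSystemLoc.maxRegQ_eq, ← lintegral_const_mul' _ _ ENNReal.ofReal_ne_top]
    refine lintegral_mono fun s ↦ ?_
    calc _ ≤ ENNReal.ofReal (Real.exp (-2 * lam * s)) * (ENNReal.ofReal lam⁻¹ * ((∑ i, ∑ j, sobolevEnergy k (fun x ↦ fderiv ℝ (fun y ↦ fderiv ℝ (w s) y (e i)) x (e j))) +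
          ENNReal.ofReal lam * ∑ i, sobolevEnergy k (fun x ↦ fderiv ℝ (w s) x (e i)) + ENNReal.ofReal (lam ^ 2) * sobolevEnergy k (w s))) :=
          mul_le_mul' le_rfl (hlow s)
      _ = _ := by ring

end Gain

/-! ### The source energy of one Picard step (time slice) -/

section Step

variable {W' : Type*} [NormedAddCommGroup W'] [InnerProductSpace ℝ W'] [FiniteDimensional ℝ W'] {ιb : Type*} [Fintype ιb]
variable [I.Boundaryless] [HasContDiffBump E'] [CompactSpace M] [T2Space M] [IsManifold I ∞ M]
variable (D : PicardData I M E' W' ιb ι)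

omit [MeasurableSpace E'] [BorelSpace E'] [FiniteDimensional ℝ W'] [I.Boundaryless] [CompactSpace M] [T2Space M] [IsManifold I ∞ M] in
/-- `cut_p • z_p(f) = cutExpr_p f`. [folklore] -/
theorem PatchSystemLoc.cut_smul_zExpr (PS : PatchSystem I M E' ι) (p : ι) (f : M → W') :
    (fun y ↦ PS.cut p y • PatchSystemLoc.zExpr PS p f y) = PatchSystemLoc.cutExpr PS p f := by
  funext y
  rw [PatchSystemLoc.cutExpr_eq_smul]
  simp only [PatchSystemLoc.zExpr_apply, smul_smul]
  by_cases hy : y ∈ tsupport (PS.cut p)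
  · rw [PS.cutPlus_eq_one_of_mem_tsupport_cut p hy, mul_one]
  · rw [image_eq_zero_of_notMem_tsupport hy, zero_mul, zero_smul]

/-- The level-independent top constant `16 |ιb|⁴ Σ_p A_p⁴`. [folklore] -/
def PicardData.ctop : ℝ := 16 * (Fintype.card ιb : ℝ) ^ 4 * ∑ p, (∑ i, ‖D.Av p i‖) ^ 4

omit [FiniteDimensional ℝ E'] [MeasurableSpace E'] [BorelSpace E'] [FiniteDimensional ℝ W'] [I.Boundaryless] [HasContDiffBump E'] [CompactSpace M] [T2Space M] [IsManifold I ∞ M] in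
/-- `ctop` is nonnegative. [folklore] -/
theorem PicardData.ctop_nonneg : 0 ≤ D.ctop := by
  rw [PicardData.ctop]; exact mul_nonneg (by positivity) (Finset.sum_nonneg fun p _ ↦ by positivity)

omit [FiniteDimensional ℝ E'] [MeasurableSpace E'] [BorelSpace E'] [FiniteDimensional ℝ W'] [I.Boundaryless] [HasContDiffBump E'] [CompactSpace M] [T2Space M] [IsManifold I ∞ M] in
/-- The per-patch top constant is dominated by `ctop`. [folklore] -/
theorem PicardData.top_le_ctop (p : ι) {δ : ℝ} :
    ENNReal.ofReal (16 * (Fintype.card ιb : ℝ) ^ 4 * (∑ i, ‖D.Av p i‖) ^ 4 * δ ^ 2) ≤ ENNReal.ofReal (D.ctop * δ ^ 2) := by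
  refine ENNReal.ofReal_le_ofReal (mul_le_mul_of_nonneg_right ?_ (sq_nonneg _))
  rw [PicardData.ctop]
  exact mul_le_mul_of_nonneg_left (Finset.single_le_sum (f := fun p ↦ (∑ i, ‖D.Av p i‖) ^ 4) (fun _ _ ↦ by positivity) (Finset.mem_univ p)) (by positivity)

/-- **The source energy of one Picard step (sharp form).** For every order `K` and every `R`
there is `B < ∞` such that for every smooth `v` with `u₀ + v` graph in `𝒪`, `ρ'`-small
own-chart jets on the supports of the cut-offs, `‖Dᵐ z_p(v)‖ ≤ R` (`m ≤ K/2 + 3`) and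
`|Gᶜ_p(y, 𝔷_p(v)(y))| ≤ δ ≤ 1`:
`Σ_p E_K(cutExpr_p Θ(v)) ≤ c_top δ² Σ_p HS_K(cutExpr_p v) + B (1 + Σ_q E_{K+1}(cutExpr_q v))`, with
`c_top` independent of `K`. [cite: TaylorPDEIII2011, Ch. 15, §7] -/
theorem PicardData.sum_energy_theta_le (K : ℕ) (R : ℝ) :
    ∃ B : ℝ≥0∞, B ≠ ⊤ ∧ ∀ {v : M → W'}, ContMDiff I 𝓘(ℝ, W') ∞ v →
      (∀ x, (x, D.u₀ x + v x) ∈ D.𝒪) → (∀ p y, D.PS.cut p y ≠ 0 → jetQ (jetOf (v ∘ (D.PS.chart p).inv) y) ≤ D.ρ' ^ 2) →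
      (∀ p, ∀ m ≤ K / 2 + 3, ∀ y, ‖iteratedFDeriv ℝ m (PatchSystemLoc.zExpr D.PS p v) y‖ ≤ R) →
      ∀ {δ : ℝ}, 0 ≤ δ → δ ≤ 1 → (∀ p i i' y, |D.Gc p i i' (y, jetOf (PatchSystemLoc.zExpr D.PS p v) y)| ≤ δ) →
      ∑ p, sobolevEnergy K (PatchSystemLoc.cutExpr D.PS p (D.theta v)) ≤
        ENNReal.ofReal (D.ctop * δ ^ 2) * ∑ p, hessEnergy K (PatchSystemLoc.cutExpr D.PS p v) +
          B * (1 + ∑ q, sobolevEnergy (K + 1) (PatchSystemLoc.cutExpr D.PS q v)) := by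
  classical
  have hflat := fun p ↦ energy_thetaFlat_le_sharp (D.Av p) K (D.PS.cut p).contDiff (D.PS.cut p).hasCompactSupport
    (Gc := D.Gc p) (fun i i' ↦ D.contDiff_Gc p i i') (fun i i' ↦ D.hasCompactSupport_Gc p i i') (D.contDiff_Gr p) (D.hasCompactSupport_Gr p)
    (D.contDiff_g₀ p) (D.hasCompactSupport_g₀ p) R
  choose Bp hBptop hBp using hflat
  obtain ⟨Cl1, hCl1top, hCl1⟩ := PatchSystemLoc.sobolevEnergy_zExpr_le D.PS (F' := W') (K + 1)
  refine ⟨(∑ p, Bp p) * (1 + Cl1), ENNReal.mul_ne_top (ENNReal.sum_ne_top.2 fun p _ ↦ hBptop p) (ENNReal.add_ne_top.2 ⟨ENNReal.one_ne_top, hCl1top⟩),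
    fun {v} hv hgv hjet hR δ hδ0 hδ1 hδ ↦ ?_⟩
  have hvq : ∀ q, ContDiffOn ℝ ∞ (v ∘ (D.PS.chart q).inv) (D.PS.chart q).target := fun q ↦ (D.PS.chart q).contDiffOn_comp_inv hv
  set X1 := ∑ q, sobolevEnergy (K + 1) (PatchSystemLoc.cutExpr D.PS q v) with hX1
  have hz : ∀ p, ContDiff ℝ ∞ (PatchSystemLoc.zExpr D.PS p v) := fun p ↦ PatchSystemLoc.contDiff_zExpr D.PS p (hvq p)
  have hzc : ∀ p, HasCompactSupport (PatchSystemLoc.zExpr D.PS p v) := fun p ↦ PatchSystemLoc.hasCompactSupport_zExpr D.PS p v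
  have hper : ∀ p, sobolevEnergy K (PatchSystemLoc.cutExpr D.PS p (D.theta v)) ≤
      ENNReal.ofReal (D.ctop * δ ^ 2) * hessEnergy K (PatchSystemLoc.cutExpr D.PS p v) + Bp p * (1 + Cl1 * X1) := by
    intro p
    rw [D.cutExpr_theta_eq p hv hgv (hjet p)]
    refine (hBp p (hz p) (hzc p) (hR p) hδ0 hδ1 (hδ p)).trans ?_
    rw [PatchSystemLoc.cut_smul_zExpr]
    exact add_le_add (mul_le_mul' (D.top_le_ctop p) le_rfl) (mul_le_mul' le_rfl (add_le_add le_rfl (hCl1 p hvq)))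
  calc ∑ p, sobolevEnergy K (PatchSystemLoc.cutExpr D.PS p (D.theta v))
      ≤ ∑ p, (ENNReal.ofReal (D.ctop * δ ^ 2) * hessEnergy K (PatchSystemLoc.cutExpr D.PS p v) + Bp p * (1 + Cl1 * X1)) := Finset.sum_le_sum fun p _ ↦ hper p
    _ = ENNReal.ofReal (D.ctop * δ ^ 2) * ∑ p, hessEnergy K (PatchSystemLoc.cutExpr D.PS p v) + (∑ p, Bp p) * (1 + Cl1 * X1) := by
        rw [Finset.sum_add_distrib, ← Finset.mul_sum, ← Finset.sum_mul]
    _ ≤ ENNReal.ofReal (D.ctop * δ ^ 2) * ∑ p, hessEnergy K (PatchSystemLoc.cutExpr D.PS p v) + (∑ p, Bp p) * ((1 + Cl1) * (1 + X1)) := by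
        gcongr
        calc 1 + Cl1 * X1 ≤ 1 + Cl1 * X1 + (X1 + Cl1) := le_self_add
          _ = (1 + Cl1) * (1 + X1) := by ring
    _ = _ := by ring

omit [MeasurableSpace E'] [BorelSpace E'] [FiniteDimensional ℝ W'] [I.Boundaryless] [HasContDiffBump E'] [CompactSpace M]
  [T2Space M] [IsManifold I ∞ M] in
/-- `cutExpr` is linear: differences. [folklore] -/
theorem PatchSystemLoc.cutExpr_sub' (PS : PatchSystem I M E' ι) (p : ι) (f g : M → W') :
    PatchSystemLoc.cutExpr PS p (fun x ↦ f x - g x) = fun y ↦ PatchSystemLoc.cutExpr PS p f y - PatchSystemLoc.cutExpr PS p g y := by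
  funext y
  by_cases hy : y ∈ (PS.chart p).target
  · simp only [PatchSystemLoc.cutExpr_of_mem PS _ hy, smul_sub]
  · simp only [PatchSystemLoc.cutExpr_of_notMem PS _ hy, sub_zero]

omit [FiniteDimensional ℝ W'] [I.Boundaryless] [HasContDiffBump E'] [CompactSpace M] [T2Space M] [IsManifold I ∞ M] in
/-- The weighted time integral of the top energies is part of the maximal-regularity quantity.
[folklore] -/
theorem lintegral_weight_hessEnergy_le_maxRegQ (K : ℕ) (lam : ℝ) (w : ℝ → E' → W') (t : ℝ) :
    (∫⁻ s in Ioo 0 t, ENNReal.ofReal (Real.exp (-2 * lam * s)) * hessEnergy K (w s)) ≤ PatchSystemLoc.maxRegQ K lam w t := by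
  rw [PatchSystemLoc.maxRegQ_eq]
  refine lintegral_mono fun s ↦ mul_le_mul' le_rfl ?_
  rw [hessEnergy_eq, add_assoc, Finset.sum_comm]
  exact le_self_add

/-- **The time-integrated source energy of one Picard step (sharp form).** For every order `K`
and every `R` there is `B < ∞` such that for every chart-slab-smooth `v` on `[0, T]` whose slices
satisfy the hypotheses of `sum_energy_theta_le`, every `λ ≥ 1` and `t ∈ [0, T]`:
`Σ_p ∫₀ᵗ e^{-2λs} E_K(cutExpr_p Θ(v s)) ≤ |ι| c_top δ² 𝒬 + B (t + λ⁻¹ 𝒬)`, `𝒬 = Σ_q maxRegQ K λ ŵ_q t`.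
[cite: TaylorPDEIII2011, Ch. 15, §7] -/
theorem PicardData.sum_lintegral_energy_theta_le (K : ℕ) (R : ℝ) :
    ∃ B : ℝ≥0∞, B ≠ ⊤ ∧ ∀ {T : ℝ}, 0 < T → ∀ {v : ℝ → M → W'},
      (∀ q, ContDiffOn ℝ ∞ (uncurry fun s y ↦ v s ((D.PS.chart q).inv y)) (Icc 0 T ×ˢ (D.PS.chart q).target)) →
      (∀ s ∈ Icc 0 T, ContMDiff I 𝓘(ℝ, W') ∞ (v s)) → (∀ s ∈ Icc 0 T, ∀ x, (x, D.u₀ x + v s x) ∈ D.𝒪) →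
      (∀ s ∈ Icc 0 T, ∀ p y, D.PS.cut p y ≠ 0 → jetQ (jetOf (v s ∘ (D.PS.chart p).inv) y) ≤ D.ρ' ^ 2) →
      (∀ s ∈ Icc 0 T, ∀ p, ∀ m ≤ K / 2 + 3, ∀ y, ‖iteratedFDeriv ℝ m (PatchSystemLoc.zExpr D.PS p (v s)) y‖ ≤ R) →
      ∀ {δ : ℝ}, 0 ≤ δ → δ ≤ 1 → (∀ s ∈ Icc 0 T, ∀ p i i' y, |D.Gc p i i' (y, jetOf (PatchSystemLoc.zExpr D.PS p (v s)) y)| ≤ δ) →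
      ∀ {lam : ℝ}, 1 ≤ lam → ∀ t ∈ Icc 0 T,
      ∑ p, (∫⁻ s in Ioo 0 t, ENNReal.ofReal (Real.exp (-2 * lam * s)) * sobolevEnergy K (PatchSystemLoc.cutExpr D.PS p (D.theta (v s)))) ≤
        (Fintype.card ι : ℝ≥0∞) * ENNReal.ofReal (D.ctop * δ ^ 2) * ∑ q, PatchSystemLoc.maxRegQ K lam (fun s ↦ PatchSystemLoc.cutExpr D.PS q (v s)) t +
          B * (ENNReal.ofReal t + ENNReal.ofReal lam⁻¹ * ∑ q, PatchSystemLoc.maxRegQ K lam (fun s ↦ PatchSystemLoc.cutExpr D.PS q (v s)) t) := by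
  classical
  obtain ⟨B, hBtop, hB⟩ := D.sum_energy_theta_le K R
  refine ⟨(Fintype.card ι : ℝ≥0∞) * B, ENNReal.mul_ne_top (ENNReal.natCast_ne_top _) hBtop, ?_⟩
  intro T hT v hv hvs hgv hjet hR δ hδ0 hδ1 hδ lam hlam t ht
  set Wt : ℝ → ℝ≥0∞ := fun s ↦ ENNReal.ofReal (Real.exp (-2 * lam * s)) with hWt
  set w : ι → ℝ → E' → W' := fun q s ↦ PatchSystemLoc.cutExpr D.PS q (v s) with hw
  have hws : ∀ q, IsSmoothSpaceTimeOn (Icc 0 T) (w q) := fun q ↦ PatchSystemLoc.isSmoothSpaceTimeOn_cutExpr D.PS q (hv q)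
  set Q := ∑ q, PatchSystemLoc.maxRegQ K lam (w q) t with hQ
  set cδ : ℝ≥0∞ := ENNReal.ofReal (D.ctop * δ ^ 2) with hcδ
  -- pointwise slice bound on `(0, t)`
  have hslice : ∀ s ∈ Ioo 0 t, ∀ p, Wt s * sobolevEnergy K (PatchSystemLoc.cutExpr D.PS p (D.theta (v s))) ≤
      Wt s * (cδ * ∑ q, hessEnergy K (w q s) + B * (1 + ∑ q, sobolevEnergy (K + 1) (w q s))) := by
    intro s hs p
    have hsI : s ∈ Icc 0 T := ⟨hs.1.le, hs.2.le.trans ht.2⟩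
    refine mul_le_mul' le_rfl ((Finset.single_le_sum (f := fun p ↦ sobolevEnergy K (PatchSystemLoc.cutExpr D.PS p (D.theta (v s))))
      (fun _ _ ↦ bot_le) (Finset.mem_univ p)).trans ?_)
    exact hB (hvs s hsI) (hgv s hsI) (hjet s hsI) (hR s hsI) hδ0 hδ1 (hδ s hsI)
  -- measurability
  have hWm : Measurable Wt := ENNReal.measurable_ofReal.comp (Real.measurable_exp.comp (measurable_const.mul measurable_id))
  have hd1 : ∀ q b, IsSmoothSpaceTimeOn (Icc 0 T) fun s y ↦ fderiv ℝ (w q s) y (stdOrthonormalBasis ℝ E' b) := fun q b ↦ isSmoothSpaceTimeOn_fderiv_apply_Icc hT (hws q) _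
  have hd2 : ∀ q a b, IsSmoothSpaceTimeOn (Icc 0 T) fun s y ↦ fderiv ℝ (fun x ↦ fderiv ℝ (w q s) x (stdOrthonormalBasis ℝ E' b)) y (stdOrthonormalBasis ℝ E' a) :=
    fun q a b ↦ isSmoothSpaceTimeOn_fderiv_apply_Icc hT (hd1 q b) _
  have hmH : ∀ q, AEMeasurable (fun s ↦ hessEnergy K (w q s)) (volume.restrict (Ioo 0 t)) := fun q ↦ by
    simp only [hessEnergy_eq]
    exact Finset.aemeasurable_fun_sum _ fun a _ ↦ Finset.aemeasurable_fun_sum _ fun b _ ↦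
      aemeasurable_sobolevEnergy_slice isOpen_Ioo K ((hd2 q a b).mono fun _ hs ↦ ⟨hs.1.le, hs.2.le.trans ht.2⟩)
  have hm2 : AEMeasurable (fun s ↦ Wt s * (cδ * ∑ q, hessEnergy K (w q s))) (volume.restrict (Ioo 0 t)) :=
    hWm.aemeasurable.mul ((Finset.aemeasurable_fun_sum _ fun q _ ↦ hmH q).const_mul _)
  have hm0 : AEMeasurable (fun s ↦ Wt s * (B * 1)) (volume.restrict (Ioo 0 t)) := hWm.aemeasurable.mul aemeasurable_const
  have hm20 : AEMeasurable (fun s ↦ Wt s * (cδ * ∑ q, hessEnergy K (w q s)) + Wt s * (B * 1)) (volume.restrict (Ioo 0 t)) := hm2.add hm0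
  -- the three integrals
  have hI2 : (∫⁻ s in Ioo 0 t, Wt s * (cδ * ∑ q, hessEnergy K (w q s))) ≤ cδ * Q := by
    have heq : (fun s ↦ Wt s * (cδ * ∑ q, hessEnergy K (w q s))) = fun s ↦ cδ * ∑ q, Wt s * hessEnergy K (w q s) := by
      funext s; rw [Finset.mul_sum, Finset.mul_sum, Finset.mul_sum]; exact Finset.sum_congr rfl fun q _ ↦ by ring
    rw [heq, lintegral_const_mul' _ _ ENNReal.ofReal_ne_top, lintegral_finsetSum' _ fun q _ ↦ ?_]
    · refine mul_le_mul' le_rfl ?_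
      rw [hQ]
      exact Finset.sum_le_sum fun q _ ↦ lintegral_weight_hessEnergy_le_maxRegQ K lam (w q) t
    · exact hWm.aemeasurable.mul (hmH q)
  have hI1 : (∫⁻ s in Ioo 0 t, Wt s * (B * ∑ q, sobolevEnergy (K + 1) (w q s))) ≤ B * (ENNReal.ofReal lam⁻¹ * Q) := by
    have heq : (fun s ↦ Wt s * (B * ∑ q, sobolevEnergy (K + 1) (w q s))) = fun s ↦ B * ∑ q, Wt s * sobolevEnergy (K + 1) (w q s) := by
      funext s; rw [Finset.mul_sum, Finset.mul_sum, Finset.mul_sum]; exact Finset.sum_congr rfl fun q _ ↦ by ring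
    rw [heq, lintegral_const_mul' _ _ hBtop, lintegral_finsetSum' _ fun q _ ↦ ?_]
    · refine mul_le_mul' le_rfl ?_
      rw [hQ, Finset.mul_sum]
      exact Finset.sum_le_sum fun q _ ↦ (lintegral_weight_sobolevEnergy_le_maxRegQ K hlam (w q) t).2
    · exact hWm.aemeasurable.mul (aemeasurable_sobolevEnergy_slice isOpen_Ioo (K + 1) ((hws q).mono fun _ hs ↦ ⟨hs.1.le, hs.2.le.trans ht.2⟩))
  have hI0 : (∫⁻ s in Ioo 0 t, Wt s * (B * 1)) ≤ B * ENNReal.ofReal t := by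
    calc (∫⁻ s in Ioo 0 t, Wt s * (B * 1)) ≤ ∫⁻ _s in Ioo 0 t, B := by
          refine setLIntegral_mono' measurableSet_Ioo fun s hs ↦ ?_
          rw [mul_one]
          refine mul_le_of_le_one_left' ?_
          rw [← ENNReal.ofReal_one]
          refine ENNReal.ofReal_le_ofReal ?_
          rw [Real.exp_le_one_iff]; nlinarith [hs.1]
      _ = B * ENNReal.ofReal t := by
          rw [setLIntegral_const, Real.volume_Ioo, sub_zero, mul_comm]
  calc ∑ p, (∫⁻ s in Ioo 0 t, Wt s * sobolevEnergy K (PatchSystemLoc.cutExpr D.PS p (D.theta (v s))))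
      ≤ ∑ _p : ι, ∫⁻ s in Ioo 0 t, Wt s * (cδ * ∑ q, hessEnergy K (w q s) + B * (1 + ∑ q, sobolevEnergy (K + 1) (w q s))) :=
        Finset.sum_le_sum fun p _ ↦ setLIntegral_mono' measurableSet_Ioo fun s hs ↦ hslice s hs p
    _ = (Fintype.card ι : ℝ≥0∞) * ((∫⁻ s in Ioo 0 t, Wt s * (cδ * ∑ q, hessEnergy K (w q s))) +
          (∫⁻ s in Ioo 0 t, Wt s * (B * 1)) + ∫⁻ s in Ioo 0 t, Wt s * (B * ∑ q, sobolevEnergy (K + 1) (w q s))) := by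
        rw [Finset.sum_const, Finset.card_univ, nsmul_eq_mul]
        congr 1
        have hfun : (fun s ↦ Wt s * (cδ * ∑ q, hessEnergy K (w q s) + B * (1 + ∑ q, sobolevEnergy (K + 1) (w q s)))) =
            fun s ↦ (Wt s * (cδ * ∑ q, hessEnergy K (w q s)) + Wt s * (B * 1)) + Wt s * (B * ∑ q, sobolevEnergy (K + 1) (w q s)) := by
          funext s; ring
        rw [hfun, lintegral_add_left' hm20, lintegral_add_left' hm2]
    _ ≤ (Fintype.card ι : ℝ≥0∞) * (cδ * Q + B * ENNReal.ofReal t + B * (ENNReal.ofReal lam⁻¹ * Q)) :=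
        mul_le_mul' le_rfl (add_le_add (add_le_add hI2 hI0) hI1)
    _ = _ := by ring

/-! ### Smallness from small energies -/

omit [FiniteDimensional ℝ E'] [MeasurableSpace E'] [BorelSpace E'] [FiniteDimensional ℝ W'] [I.Boundaryless] [HasContDiffBump E'] [T2Space M] [IsManifold I ∞ M] in
/-- **A tube around the graph of `u₀`.** [folklore] -/
theorem PicardData.exists_tube : ∃ r : ℝ, 0 < r ∧ ∀ (x : M) (w : W'), ‖w‖ < r → (x, D.u₀ x + w) ∈ D.𝒪 := by
  set Ψ : M × W' → M × W' := fun q ↦ (q.1, D.u₀ q.1 + q.2) with hΨ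
  have hΨc : Continuous Ψ := continuous_fst.prodMk ((D.hu₀.continuous.comp continuous_fst).add continuous_snd)
  have hopen : IsOpen (Ψ ⁻¹' D.𝒪) := D.h𝒪.preimage hΨc
  have hsub : (univ : Set M) ×ˢ ({0} : Set W') ⊆ Ψ ⁻¹' D.𝒪 := by
    rintro ⟨x, w⟩ ⟨-, hw⟩
    rw [mem_singleton_iff] at hw
    subst hw
    simpa [hΨ] using D.hg₀ x
  obtain ⟨U, V, -, hV, hU, h0V, hUV⟩ := generalized_tube_lemma isCompact_univ isCompact_singleton hopen hsub
  obtain ⟨r, hr, hrV⟩ := Metric.isOpen_iff.1 hV 0 (h0V (mem_singleton 0))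
  refine ⟨r, hr, fun x w hw ↦ ?_⟩
  have h : (x, w) ∈ Ψ ⁻¹' D.𝒪 := hUV (mk_mem_prod (hU (mem_univ x)) (hrV (by simpa using hw)))
  simpa [hΨ] using h

omit [MeasurableSpace E'] [BorelSpace E'] [FiniteDimensional ℝ W'] [HasContDiffBump E'] in
/-- `jetQ(J) ≤ (n + 1) ‖J‖²`. [folklore] -/
theorem jetQ_le_norm_sq (J : W' × (E' →L[ℝ] W')) : jetQ J ≤ ((Module.finrank ℝ E' : ℝ) + 1) * ‖J‖ ^ 2 := by
  rw [jetQ]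
  have h1 : ‖J.1‖ ^ 2 ≤ ‖J‖ ^ 2 := pow_le_pow_left₀ (norm_nonneg _) (norm_fst_le J) 2
  have h2 : ∀ i, ‖J.2 (stdOrthonormalBasis ℝ E' i)‖ ^ 2 ≤ ‖J‖ ^ 2 := fun i ↦ by
    refine pow_le_pow_left₀ (norm_nonneg _) ?_ 2
    calc ‖J.2 (stdOrthonormalBasis ℝ E' i)‖ ≤ ‖J.2‖ * ‖stdOrthonormalBasis ℝ E' i‖ := J.2.le_opNorm _
      _ = ‖J.2‖ := by rw [(stdOrthonormalBasis ℝ E').orthonormal.1, mul_one]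
      _ ≤ ‖J‖ := norm_snd_le J
  calc ‖J.1‖ ^ 2 + ∑ i, ‖J.2 (stdOrthonormalBasis ℝ E' i)‖ ^ 2 ≤ ‖J‖ ^ 2 + ∑ _i : Fin (Module.finrank ℝ E'), ‖J‖ ^ 2 :=
        add_le_add h1 (Finset.sum_le_sum fun i _ ↦ h2 i)
    _ = ((Module.finrank ℝ E' : ℝ) + 1) * ‖J‖ ^ 2 := by rw [Finset.sum_const, Finset.card_univ, Fintype.card_fin, nsmul_eq_mul]; ring

omit [FiniteDimensional ℝ E'] [MeasurableSpace E'] [BorelSpace E'] [FiniteDimensional ℝ W'] [I.Boundaryless] [HasContDiffBump E'] [CompactSpace M] [T2Space M] [IsManifold I ∞ M] in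
/-- The jet is bounded by the function and its derivative: `‖𝔷(y)‖ ≤ max ‖D⁰z‖ ‖D¹z‖`. [folklore] -/
theorem norm_jetOf_le {z : E' → W'} {R : ℝ} (h0 : ∀ y, ‖iteratedFDeriv ℝ 0 z y‖ ≤ R) (h1 : ∀ y, ‖iteratedFDeriv ℝ 1 z y‖ ≤ R) (y : E') :
    ‖jetOf z y‖ ≤ R := by
  rw [jetOf_apply, Prod.norm_def]
  refine max_le ?_ ?_
  · simpa using h0 y
  · have h := h1 y
    rwa [← norm_iteratedFDeriv_fderiv, norm_iteratedFDeriv_zero] at h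

/-- **Smallness from small energies.** For every `m₀ ≥ 1` there are `ε₀ > 0` and constants
`C_s, C_δ ≥ 0` such that for every smooth `v` and `0 ≤ ε ≤ ε₀` with
`E_{m₀ + n'}(cutExpr_q v) ≤ ε²` for all `q`: the graph of `u₀ + v` lies in `𝒪`, the own-chart jets
are `ρ'`-small on the supports of the cut-offs, `‖Dᵐ z_p(v)‖ ≤ C_s ε` (`m ≤ m₀`), and
`|Gᶜ_p(y, 𝔷_p(v)(y))| ≤ C_δ ε`. [cite: TaylorPDEIII2011, Ch. 15, §7] -/
theorem PicardData.small_of_energy_le (m₀ : ℕ) (hm₀ : 1 ≤ m₀) :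
    ∃ ε₀ : ℝ, 0 < ε₀ ∧ ∃ Cs : ℝ, 0 ≤ Cs ∧ ∃ Cδ : ℝ, 0 ≤ Cδ ∧ ∀ {v : M → W'}, ContMDiff I 𝓘(ℝ, W') ∞ v →
      ∀ {ε : ℝ}, 0 ≤ ε → ε ≤ ε₀ →
      (∀ q, sobolevEnergy (m₀ + 2 * (Module.finrank ℝ E' + 1)) (PatchSystemLoc.cutExpr D.PS q v) ≤ ENNReal.ofReal (ε ^ 2)) →
      (∀ x, (x, D.u₀ x + v x) ∈ D.𝒪) ∧
      (∀ p y, D.PS.cut p y ≠ 0 → jetQ (jetOf (v ∘ (D.PS.chart p).inv) y) ≤ D.ρ' ^ 2) ∧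
      (∀ p, ∀ m ≤ m₀, ∀ y, ‖iteratedFDeriv ℝ m (PatchSystemLoc.zExpr D.PS p v) y‖ ≤ Cs * ε) ∧
      (∀ p i i' y, |D.Gc p i i' (y, jetOf (PatchSystemLoc.zExpr D.PS p v) y)| ≤ Cδ * ε) := by
  classical
  set n := Module.finrank ℝ E' with hn
  obtain ⟨Cs, hCs0, hCs⟩ := PatchSystemLoc.norm_iteratedFDeriv_zExpr_le D.PS (F' := W') m₀
  obtain ⟨r, hr, hrO⟩ := D.exists_tube
  -- Lipschitz constants of the cut-off top coefficients
  have hL : ∀ p i i', ∃ L : NNReal, LipschitzWith L (D.Gc p i i') := fun p i i' ↦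
    (D.contDiff_Gc p i i').lipschitzWith_of_hasCompactSupport (D.hasCompactSupport_Gc p i i') (by norm_cast)
  choose L hL using hL
  set Lmax : ℝ := ∑ p, ∑ i, ∑ i', (L p i i' : ℝ) with hLmax
  have hLmax0 : 0 ≤ Lmax := Finset.sum_nonneg fun _ _ ↦ Finset.sum_nonneg fun _ _ ↦ Finset.sum_nonneg fun _ _ ↦ NNReal.coe_nonneg _
  have hLi : ∀ p i i', (L p i i' : ℝ) ≤ Lmax := fun p i i' ↦
    ((Finset.single_le_sum (f := fun i' ↦ (L p i i' : ℝ)) (fun _ _ ↦ NNReal.coe_nonneg _) (Finset.mem_univ i')).trans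
      (Finset.single_le_sum (f := fun i ↦ ∑ i', (L p i i' : ℝ)) (fun _ _ ↦ Finset.sum_nonneg fun _ _ ↦ NNReal.coe_nonneg _) (Finset.mem_univ i))).trans
      (Finset.single_le_sum (f := fun p ↦ ∑ i, ∑ i', (L p i i' : ℝ)) (fun _ _ ↦ Finset.sum_nonneg fun _ _ ↦ Finset.sum_nonneg fun _ _ ↦ NNReal.coe_nonneg _)
        (Finset.mem_univ p))
  -- the threshold
  set ε₀ : ℝ := min (r / (2 * (Cs + 1))) (D.ρ' / (((n : ℝ) + 1) * (Cs + 1))) with hε₀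
  have hε₀pos : 0 < ε₀ := lt_min (by have := hCs0; positivity) (by have := D.hρ'; have := hCs0; positivity)
  refine ⟨ε₀, hε₀pos, Cs, hCs0, Lmax * Cs, mul_nonneg hLmax0 hCs0, fun {v} hv ε hε hεε₀ hE ↦ ?_⟩
  have hvq : ∀ q, ContDiffOn ℝ ∞ (v ∘ (D.PS.chart q).inv) (D.PS.chart q).target := fun q ↦ (D.PS.chart q).contDiffOn_comp_inv hv
  have hsup : ∀ p, ∀ m ≤ m₀, ∀ y, ‖iteratedFDeriv ℝ m (PatchSystemLoc.zExpr D.PS p v) y‖ ≤ Cs * ε := fun p m hm y ↦ hCs p hvq hε hE m hm y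
  have hjetn : ∀ p y, ‖jetOf (PatchSystemLoc.zExpr D.PS p v) y‖ ≤ Cs * ε := fun p y ↦
    norm_jetOf_le (fun y ↦ hsup p 0 (Nat.zero_le _) y) (fun y ↦ hsup p 1 hm₀ y) y
  have hCsε : Cs * ε ≤ Cs * ε₀ := mul_le_mul_of_nonneg_left hεε₀ hCs0
  refine ⟨fun x ↦ ?_, fun p y hy ↦ ?_, hsup, fun p i i' y ↦ ?_⟩
  · -- graph: `‖v x‖ ≤ Cs ε < r`
    refine hrO x (v x) (lt_of_le_of_lt (PatchSystemLoc.norm_apply_le_of_zExpr D.PS v (R := Cs * ε) (fun p y ↦ ?_) x) ?_)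
    · have h := hsup p 0 (Nat.zero_le _) y
      rwa [norm_iteratedFDeriv_zero] at h
    · calc Cs * ε ≤ Cs * ε₀ := hCsε
        _ ≤ Cs * (r / (2 * (Cs + 1))) := mul_le_mul_of_nonneg_left (min_le_left _ _) hCs0
        _ < r := by
            rw [mul_div_assoc']
            rw [div_lt_iff₀ (by positivity)]
            nlinarith
  · -- jets on the support of `cut_p`: there `z_p = v̂_p` near `y`
    have hyb : y ∈ ball (0 : E') (3 * D.PS.r p) := by
      have h : y ∈ Function.support (D.PS.cut p) := hy
      rwa [ContDiffBump.support_eq] at h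
    have hnear := PatchSystemLoc.zExpr_eventuallyEq D.PS p v hyb
    have hjet0 : jetOf (v ∘ (D.PS.chart p).inv) y = jetOf (PatchSystemLoc.zExpr D.PS p v) y := by
      rw [jetOf_apply, jetOf_apply, hnear.fderiv_eq, hnear.eq_of_nhds]
    rw [hjet0]
    refine (jetQ_le_norm_sq _).trans ?_
    have hb : ‖jetOf (PatchSystemLoc.zExpr D.PS p v) y‖ ≤ D.ρ' / ((n : ℝ) + 1) := by
      refine (hjetn p y).trans (hCsε.trans ?_)
      calc Cs * ε₀ ≤ Cs * (D.ρ' / (((n : ℝ) + 1) * (Cs + 1))) := mul_le_mul_of_nonneg_left (min_le_right _ _) hCs0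
        _ ≤ (Cs + 1) * (D.ρ' / (((n : ℝ) + 1) * (Cs + 1))) := mul_le_mul_of_nonneg_right (by linarith) (by have := D.hρ'; positivity)
        _ = D.ρ' / ((n : ℝ) + 1) := by field_simp
    have hn1 : (1 : ℝ) ≤ (n : ℝ) + 1 := by have : (0 : ℝ) ≤ n := Nat.cast_nonneg _; linarith
    calc ((n : ℝ) + 1) * ‖jetOf (PatchSystemLoc.zExpr D.PS p v) y‖ ^ 2 ≤ ((n : ℝ) + 1) * (D.ρ' / ((n : ℝ) + 1)) ^ 2 :=
          mul_le_mul_of_nonneg_left (pow_le_pow_left₀ (norm_nonneg _) hb 2) (by positivity)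
      _ = D.ρ' ^ 2 / ((n : ℝ) + 1) := by field_simp
      _ ≤ D.ρ' ^ 2 := div_le_self (sq_nonneg _) hn1
  · -- the top coefficient: Lipschitz and vanishing at the zero jet
    have h := (hL p i i').dist_le_mul (y, jetOf (PatchSystemLoc.zExpr D.PS p v) y) (y, 0)
    rw [D.Gc_zero, Real.dist_eq, sub_zero, Prod.dist_eq, dist_self, dist_zero_right] at h
    refine h.trans ?_
    calc (L p i i' : ℝ) * max 0 ‖jetOf (PatchSystemLoc.zExpr D.PS p v) y‖ = (L p i i' : ℝ) * ‖jetOf (PatchSystemLoc.zExpr D.PS p v) y‖ := by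
          rw [max_eq_right (norm_nonneg _)]
      _ ≤ Lmax * (Cs * ε) := mul_le_mul (hLi p i i') (hjetn p y) (norm_nonneg _) hLmax0
      _ = Lmax * Cs * ε := by ring

/-! ### The source energy of differences (contraction) -/

omit [MeasurableSpace E'] [BorelSpace E'] [FiniteDimensional ℝ W'] [I.Boundaryless] [HasContDiffBump E'] [CompactSpace M] [T2Space M] [IsManifold I ∞ M] in
/-- `zExpr` is linear: differences. [folklore] -/
theorem PatchSystemLoc.zExpr_sub (PS : PatchSystem I M E' ι) (p : ι) (f g : M → W') :
    PatchSystemLoc.zExpr PS p (fun x ↦ f x - g x) = fun y ↦ PatchSystemLoc.zExpr PS p f y - PatchSystemLoc.zExpr PS p g y := by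
  funext y; simp [PatchSystemLoc.zExpr, smul_sub]

/-- **The source energy of differences (sharp form).** For every order `K` and every `R` there
is `B < ∞` such that for smooth `v, v'` with admissible graphs, `ρ'`-small own-chart jets, all
derivatives up to `K + 2` of `z_p(v), z_p(v')` bounded by `R`, and `|Gᶜ_p(y, 𝔷_p(v)(y))| ≤ δ ≤ 1`:
`Σ_p E_K(cutExpr_p (Θ(v) - Θ(v'))) ≤ c_top δ² Σ_p HS_K(cutExpr_p (v - v')) + B Σ_q E_{K+1}(cutExpr_q (v - v'))`.
[cite: TaylorPDEIII2011, Ch. 15, §7] -/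
theorem PicardData.sum_energy_theta_sub_le (K : ℕ) (R : ℝ) :
    ∃ B : ℝ≥0∞, B ≠ ⊤ ∧ ∀ {v v' : M → W'}, ContMDiff I 𝓘(ℝ, W') ∞ v → ContMDiff I 𝓘(ℝ, W') ∞ v' →
      (∀ x, (x, D.u₀ x + v x) ∈ D.𝒪) → (∀ x, (x, D.u₀ x + v' x) ∈ D.𝒪) →
      (∀ p y, D.PS.cut p y ≠ 0 → jetQ (jetOf (v ∘ (D.PS.chart p).inv) y) ≤ D.ρ' ^ 2) →
      (∀ p y, D.PS.cut p y ≠ 0 → jetQ (jetOf (v' ∘ (D.PS.chart p).inv) y) ≤ D.ρ' ^ 2) →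
      (∀ p, ∀ m ≤ K + 2, ∀ y, ‖iteratedFDeriv ℝ m (PatchSystemLoc.zExpr D.PS p v) y‖ ≤ R) →
      (∀ p, ∀ m ≤ K + 2, ∀ y, ‖iteratedFDeriv ℝ m (PatchSystemLoc.zExpr D.PS p v') y‖ ≤ R) →
      ∀ {δ : ℝ}, 0 ≤ δ → δ ≤ 1 → (∀ p i i' y, |D.Gc p i i' (y, jetOf (PatchSystemLoc.zExpr D.PS p v) y)| ≤ δ) →
      ∑ p, sobolevEnergy K (PatchSystemLoc.cutExpr D.PS p (fun x ↦ D.theta v x - D.theta v' x)) ≤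
        ENNReal.ofReal (D.ctop * δ ^ 2) * ∑ p, hessEnergy K (PatchSystemLoc.cutExpr D.PS p (fun x ↦ v x - v' x)) +
          B * ∑ q, sobolevEnergy (K + 1) (PatchSystemLoc.cutExpr D.PS q (fun x ↦ v x - v' x)) := by
  classical
  have hflat := fun p ↦ energy_thetaFlat_sub_le_sharp (D.Av p) K (D.PS.cut p).contDiff (D.PS.cut p).hasCompactSupport
    (Gc := D.Gc p) (fun i i' ↦ D.contDiff_Gc p i i') (fun i i' ↦ D.hasCompactSupport_Gc p i i') (D.contDiff_Gr p) (D.hasCompactSupport_Gr p) (D.g₀ p) R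
  choose Bp hBptop hBp using hflat
  obtain ⟨Cl1, hCl1top, hCl1⟩ := PatchSystemLoc.sobolevEnergy_zExpr_le D.PS (F' := W') (K + 1)
  refine ⟨(∑ p, Bp p) * Cl1, ENNReal.mul_ne_top (ENNReal.sum_ne_top.2 fun p _ ↦ hBptop p) hCl1top,
    fun {v v'} hv hv' hgv hgv' hjet hjet' hR hR' δ hδ0 hδ1 hδ ↦ ?_⟩
  have hvq : ∀ q, ContDiffOn ℝ ∞ (v ∘ (D.PS.chart q).inv) (D.PS.chart q).target := fun q ↦ (D.PS.chart q).contDiffOn_comp_inv hv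
  have hvq' : ∀ q, ContDiffOn ℝ ∞ (v' ∘ (D.PS.chart q).inv) (D.PS.chart q).target := fun q ↦ (D.PS.chart q).contDiffOn_comp_inv hv'
  have hwq : ∀ q, ContDiffOn ℝ ∞ ((fun x ↦ v x - v' x) ∘ (D.PS.chart q).inv) (D.PS.chart q).target := fun q ↦ (hvq q).sub (hvq' q)
  set X1 := ∑ q, sobolevEnergy (K + 1) (PatchSystemLoc.cutExpr D.PS q (fun x ↦ v x - v' x)) with hX1
  have hz : ∀ p, ContDiff ℝ ∞ (PatchSystemLoc.zExpr D.PS p v) := fun p ↦ PatchSystemLoc.contDiff_zExpr D.PS p (hvq p)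
  have hz' : ∀ p, ContDiff ℝ ∞ (PatchSystemLoc.zExpr D.PS p v') := fun p ↦ PatchSystemLoc.contDiff_zExpr D.PS p (hvq' p)
  have hper : ∀ p, sobolevEnergy K (PatchSystemLoc.cutExpr D.PS p (fun x ↦ D.theta v x - D.theta v' x)) ≤
      ENNReal.ofReal (D.ctop * δ ^ 2) * hessEnergy K (PatchSystemLoc.cutExpr D.PS p (fun x ↦ v x - v' x)) + Bp p * (Cl1 * X1) := by
    intro p
    rw [PatchSystemLoc.cutExpr_sub', D.cutExpr_theta_eq p hv hgv (hjet p), D.cutExpr_theta_eq p hv' hgv' (hjet' p)]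
    refine (hBp p (hz p) (hz' p) (hR p) (hR' p) hδ0 hδ1 (hδ p)).trans ?_
    have hzw : (fun y ↦ D.PS.cut p y • (PatchSystemLoc.zExpr D.PS p v y - PatchSystemLoc.zExpr D.PS p v' y)) = PatchSystemLoc.cutExpr D.PS p (fun x ↦ v x - v' x) := by
      rw [← PatchSystemLoc.cut_smul_zExpr, PatchSystemLoc.zExpr_sub]
    rw [hzw, ← PatchSystemLoc.zExpr_sub]
    exact add_le_add (mul_le_mul' (D.top_le_ctop p) le_rfl) (mul_le_mul' le_rfl (hCl1 p hwq))
  calc ∑ p, sobolevEnergy K (PatchSystemLoc.cutExpr D.PS p (fun x ↦ D.theta v x - D.theta v' x))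
      ≤ ∑ p, (ENNReal.ofReal (D.ctop * δ ^ 2) * hessEnergy K (PatchSystemLoc.cutExpr D.PS p (fun x ↦ v x - v' x)) + Bp p * (Cl1 * X1)) :=
        Finset.sum_le_sum fun p _ ↦ hper p
    _ = _ := by rw [Finset.sum_add_distrib, ← Finset.mul_sum, ← Finset.sum_mul, mul_assoc]

end Step

end Literature.Analysis.PDE
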